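import Summits.AtomisticToContinuum.BoseEinsteinCondensation.Theorems.BECCutLineWeakDisorderLateCoreSplitNearGroundState
import Summits.AtomisticToContinuum.BoseEinsteinCondensation.Theorems.BECCutLineWeakDisorderLateCoreSplitZeroModeGroundState
import Summits.AtomisticToContinuum.BoseEinsteinCondensation.Theorems.BECCutLineWeakDisorderLateCoreSplitSummitNecessity
import Summits.AtomisticToContinuum.BoseEinsteinCondensation.Theorems.BECCutLineWeakDisorderZeroModeOfLandscape
import Summits.AtomisticToContinuum.BoseEinsteinCondensation.Theses.BECInfraredBound
import HarnessLib

/-!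
# Crux `TwoReplicaTransienceBound` (stmt-AtomisticToContinuum-9687), line `late-core-split`:
# the open core stub `Z` ALONE is summit-strength BY NAME — and IS item 0686 on bounded potentials

Support file (`--supports stmt-AtomisticToContinuum-9687`; registered toolbox stub
`stub_zeroModeSummitNecessityBounded`; lead c22).

The held skeleton `Cruxes/TwoReplicaTransienceBound/Lines/late_core_split.lean` reduces the crux
losslessly to `Z ∧ A ∧ O` (`stub_splitOfCrux`, p140379) and everything provable in it has landed. Two
kernel certificates so far locate the difficulty: the CRUX implies LSSY's criterion `HasGroundStateBEC v ρ`
on every essentially bounded admissible `v` (`stub_summitNecessityBounded`, p153414 — through the proved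
transfer `WitnessTransfer`, which consumes the full two-replica ratio bound, i.e. `Z ∧ A`), and the STUB
`Z = WitnessZeroMode` restricted to bounded `v` is equivalent to flat-mode ODLRO `∫ s_{Ψ₀}² ≥ cL³` of the
Feynman–Kac ground state `Ψ₀`, uniformly in `N` (`witnessZeroModeBdd_iff_groundStateZeroMode`, p140987) —
LSSY's (1.19) for `Ψ₀` itself, but not yet the summit predicate, which quantifies over ALL near-minimising
trial states. This file closes that gap WITHOUT the no-intermittency input `A` (tools in
`…LateCoreSplitNearGroundState.lean`: occupation stability against a continuous reference, the flat-mode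
occupation of a nonnegative function, near-minimisers `L²`-close to `Ψ₀` up to a phase):

* `zeroModeAt_of_groundStateZeroModeAt` — ground-state flat-mode ODLRO at a bounded `v` gives the
  zero-mode statement of item stmt-AtomisticToContinuum-0686 at `v` (constant `c/4`,
  `zeroMode_sqrt_bookkeeping`); `groundStateZeroModeAt_of_zeroModeAt` — and conversely (constant `c/4`);
* **`witnessZeroModeBdd_iff_becZeroModeBdd`: restricted to bounded admissible potentials, the open stub
  `Z` is EQUIVALENT, by name, to the statement of item stmt-AtomisticToContinuum-0686
  (`BECInfraredBound.BecZeroModeThesis`, X_B1, wanted by seven routes)**; in particular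
  `witnessZeroModeBdd_of_becZeroModeThesis`;
* **`stub_zeroModeSummitNecessityBounded`**: `WitnessZeroMode → ∀` bounded admissible `v`, `∃ ρ₀ > 0`,
  `∀ ρ ∈ (0, ρ₀)`, `HasGroundStateBEC v ρ` — the open stub `stub_witnessZeroMode` of the line ALONE
  contains the summit conjunct's defining property on soft potentials (`hasGroundStateBEC_of_zeroModeAt`,
  p153414); with the 0686 form (`becZeroModeAt_bounded_of_witnessZeroMode`), the contrapositive refutation
  test (`not_witnessZeroMode_of_not_hasGroundStateBEC`) and the by-name gap to the sub-problem
  (`boseEinsteinCondensation_of_witnessZeroMode_of_singularBEC`).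

Reading (LeadC22Report): the `promote-stub` verdict on `stub_witnessZeroMode` rests on by-name
certificates of the exact shapes `stub → HasGroundStateBEC` and `stub|bdd ↔ item 0686|bdd`.

## References

* E. H. Lieb, R. Seiringer, J. P. Solovej, J. Yngvason, *The Mathematics of the Bose Gas and its
  Condensation* (2005), §1.2 (1.17)–(1.19), Ch. 5. [LSSY2005]
* M. Reed, B. Simon, *Methods of Modern Mathematical Physics IV* (1978), §XIII.12 Thms XIII.46–47.
  [ReedSimonIV1978]
-/

noncomputable section

namespace Summit.AtomisticToContinuum.BoseEinsteinCondensation.Cruxes.TwoReplicaTransienceBound.LateCoreSplit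

open MeasureTheory Filter Set
open scoped ENNReal NNReal Topology ComplexConjugate
open Literature.MathematicalPhysics.QuantumManyBody
open Literature.MathematicalPhysics.QuantumManyBody.BoseGas
open Summit.AtomisticToContinuum.BoseEinsteinCondensation.Theses
open Summit.AtomisticToContinuum.BoseEinsteinCondensation.Theses.BECCutLineWeakDisorder
open Summit.AtomisticToContinuum.BoseEinsteinCondensation.Theorems
open Summit.AtomisticToContinuum.BoseEinsteinCondensation.Theorems.CutLineWitness
open Summit.AtomisticToContinuum.BoseEinsteinCondensation.Theorems.OccupationStability

/-! ### Ground-state flat-mode ODLRO at `v` ⟹ the zero-mode statement at `v` -/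

/-- **Ground-state flat-mode ODLRO at one bounded potential gives the zero-mode statement of item
stmt-AtomisticToContinuum-0686 at that potential.** If for small `ρ`, some `c > 0` and all large `n`
every Feynman–Kac ground state `Ψ₀` of `n+1` bosons in the box of side `((n+1)/ρ)^{1/3}` has
`∫ s_{Ψ₀}² ≥ c L³`, then at every such `ρ`, for all large `N`, some `δ > 0` makes every
`δ`-near-minimising trial state occupy the flat mode `φ₀ = L^{-3/2} 1_Λ` with `≥ (c/4) N` particles:
the ground state exists and is continuous (`exists_isGroundStateFK_isGroundState`), its own flat-mode
occupation is `≥ cN` (`occupation_constMode_ofReal`), near-minimisers are `(c/4)`-close to it up to a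
phase (`nearMinimiser_close_fkGroundState`), and `√occ` is `√N`-Lipschitz in `L²`
(`sqrt_occupation_le_of_continuous`, `zeroMode_sqrt_bookkeeping`). [cite: LSSY2005, §1.2 (1.19)] -/
theorem zeroModeAt_of_groundStateZeroModeAt (v : ℝ → ℝ≥0∞) (hv : Measurable v)
    (hb : ∃ C : ℝ≥0, ∀ r, v r ≤ C)
    (hG : ∃ ρ₀ : ℝ, 0 < ρ₀ ∧ ∀ ρ : ℝ, 0 < ρ → ρ < ρ₀ → ∃ c : ℝ, 0 < c ∧ ∀ᶠ n : ℕ in atTop,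
      ∀ Ψ₀ : Config (n + 1) → ℝ, IsGroundStateFK v (sideLength ρ (n + 1)) Ψ₀ →
        ENNReal.ofReal (c * sideLength ρ (n + 1) ^ 3) ≤
          ∫⁻ Y : Config n, (∫⁻ x, (‖Ψ₀ (Matrix.vecCons x Y)‖₊ : ℝ≥0∞)) ^ 2) :
    ∃ ρ₀ : ℝ, 0 < ρ₀ ∧ ∀ ρ : ℝ, 0 < ρ → ρ < ρ₀ → ∃ c : ℝ, 0 < c ∧ ∀ᶠ N : ℕ in atTop,
      ∃ δ : ℝ≥0∞, 0 < δ ∧ ∀ Ψ : TrialState N (sideLength ρ N),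
        energy v Ψ ≤ groundStateEnergy v N (sideLength ρ N) + δ →
        ENNReal.ofReal (c * N) ≤ occupation N ((box (sideLength ρ N)).indicator
          fun _ => ((Real.sqrt (sideLength ρ N ^ 3))⁻¹ : ℂ)) Ψ.ψ := by
  obtain ⟨C, hC⟩ := hb
  obtain ⟨ρ₁, hρ₁, H₁⟩ := hG
  refine ⟨ρ₁, hρ₁, fun ρ hρ hρlt => ?_⟩
  obtain ⟨c, hc, hev⟩ := H₁ ρ hρ hρlt
  refine ⟨c / 4, by positivity, ?_⟩
  obtain ⟨n₀, hn₀⟩ := Filter.eventually_atTop.mp hev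
  refine Filter.eventually_atTop.mpr ⟨n₀ + 1, fun N hN => ?_⟩
  obtain ⟨n, rfl⟩ : ∃ n, N = n + 1 := ⟨N - 1, by omega⟩
  have hGn := hn₀ n (by omega)
  set L := sideLength ρ (n + 1) with hLdef
  have hLpos : 0 < L := by
    rw [hLdef]
    unfold sideLength
    exact Real.rpow_pos_of_pos (div_pos (Nat.cast_pos.mpr (Nat.succ_pos n)) hρ) _
  have hL3 : 0 < L ^ 3 := by positivity
  have hN1 : 1 ≤ n + 1 := Nat.le_add_left 1 n
  -- the Feynman–Kac ground state in this box and its flat-mode ODLRO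
  obtain ⟨Ψ₀, hFK, -, hcont, -⟩ :=
    BECInsertionVariance.exists_isGroundStateFK_isGroundState hN1 hLpos hv ⟨C, hC⟩
  have hS := hGn Ψ₀ hFK
  -- tolerance `η = c/4`
  obtain ⟨δ, hδ, hclose⟩ :=
    nearMinimiser_close_fkGroundState hv hC hLpos hN1 hFK (η := c / 4) (by positivity)
  refine ⟨δ, hδ, fun Φ hΦE => ?_⟩
  obtain ⟨cc, hcc, hE⟩ := hclose Φ hΦE
  set φ₀ : Space → ℂ := (box L).indicator fun _ => ((Real.sqrt (L ^ 3))⁻¹ : ℂ) with hφ₀def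
  have hφm : AEStronglyMeasurable φ₀ volume :=
    _root_.AtomisticToContinuum.BECInfraredBound.aestronglyMeasurable_constMode L
  have hφ1 : ∫⁻ x, (‖φ₀ x‖₊ : ℝ≥0∞) ^ 2 = 1 :=
    _root_.AtomisticToContinuum.BECInfraredBound.lintegral_constMode_sq hLpos
  -- the reference occupation
  have hoccref : occupation (n + 1) φ₀ (fun X => (Ψ₀ X : ℂ)) =
      (n + 1 : ℝ≥0∞) * ((ENNReal.ofReal (L ^ 3))⁻¹ *
        ∫⁻ Y : Config n, (∫⁻ x, (‖Ψ₀ (Matrix.vecCons x Y)‖₊ : ℝ≥0∞)) ^ 2) :=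
    occupation_constMode_ofReal hLpos hcont hFK.eq_zero hFK.nonneg
  set K : ℝ≥0∞ := ENNReal.ofReal (1 / c) with hKdef
  have hK0 : K ≠ 0 := (ENNReal.ofReal_pos.mpr (by positivity)).ne'
  have hKc : K = (ENNReal.ofReal c)⁻¹ := by rw [hKdef, one_div, ENNReal.ofReal_inv_of_pos hc]
  have hA0 : ENNReal.ofReal (L ^ 3) ≠ 0 := (ENNReal.ofReal_pos.2 hL3).ne'
  have hAt : ENNReal.ofReal (L ^ 3) ≠ ⊤ := ENNReal.ofReal_ne_top
  have hc0 : ENNReal.ofReal c ≠ 0 := (ENNReal.ofReal_pos.2 hc).ne'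
  have hct : ENNReal.ofReal c ≠ ⊤ := ENNReal.ofReal_ne_top
  have hNcast : ((n + 1 : ℕ) : ℝ≥0∞) = (n + 1 : ℝ≥0∞) := by push_cast; rfl
  have h1 : ((n + 1 : ℕ) : ℝ≥0∞) ≤ occupation (n + 1) φ₀ (fun X => (Ψ₀ X : ℂ)) * K := by
    rw [hoccref, ← hNcast]
    have hone : (1 : ℝ≥0∞) = ((ENNReal.ofReal (L ^ 3))⁻¹ * ENNReal.ofReal (c * L ^ 3)) * K := by
      rw [ENNReal.ofReal_mul hc.le, hKc, mul_comm (ENNReal.ofReal c) (ENNReal.ofReal (L ^ 3)),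
        ← mul_assoc, ENNReal.inv_mul_cancel hA0 hAt, one_mul, ENNReal.mul_inv_cancel hc0 hct]
    calc ((n + 1 : ℕ) : ℝ≥0∞) = ((n + 1 : ℕ) : ℝ≥0∞) * 1 := (mul_one _).symm
      _ = ((n + 1 : ℕ) : ℝ≥0∞) * (((ENNReal.ofReal (L ^ 3))⁻¹ * ENNReal.ofReal (c * L ^ 3)) * K) := by
          rw [← hone]
      _ ≤ ((n + 1 : ℕ) : ℝ≥0∞) * (((ENNReal.ofReal (L ^ 3))⁻¹ *
            ∫⁻ Y : Config n, (∫⁻ x, (‖Ψ₀ (Matrix.vecCons x Y)‖₊ : ℝ≥0∞)) ^ 2) * K) := by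
          gcongr
      _ = _ := by ring
  have h2 := sqrt_occupation_le_of_continuous hφm hφ1 (Ψ := fun X => (Ψ₀ X : ℂ))
    (Complex.continuous_ofReal.comp hcont) Φ.contDiff.continuous hcc
  have hE' : ∫⁻ X, (‖(Ψ₀ X : ℂ) - cc * Φ.ψ X‖₊ : ℝ≥0∞) ^ 2 ≤ (4 * K)⁻¹ := by
    refine hE.trans (le_of_eq ?_)
    rw [hKdef, show c / 4 = (4 * (1 / c))⁻¹ by field_simp, ENNReal.ofReal_inv_of_pos (by positivity),
      ENNReal.ofReal_mul (by norm_num), ENNReal.ofReal_ofNat]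
  have key := zeroMode_sqrt_bookkeeping hK0 (ENNReal.natCast_ne_top (n + 1)) h1 h2 hE'
  calc ENNReal.ofReal (c / 4 * ((n + 1 : ℕ) : ℝ))
      = ((n + 1 : ℕ) : ℝ≥0∞) / (4 * K) := by
        rw [show c / 4 = 1 / (4 * (1 / c)) by field_simp, ENNReal.ofReal_mul (by positivity),
          ENNReal.ofReal_natCast, hKdef, one_div, ENNReal.ofReal_inv_of_pos (by positivity),
          ENNReal.ofReal_mul (by norm_num), ENNReal.ofReal_ofNat, ENNReal.div_eq_inv_mul, mul_comm]
    _ ≤ _ := key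

/-! ### Conversely: the zero-mode statement at `v` ⟹ ground-state flat-mode ODLRO at `v` -/

/-- **The zero-mode statement of item stmt-AtomisticToContinuum-0686 at one bounded potential gives
ground-state flat-mode ODLRO there** (the converse of `zeroModeAt_of_groundStateZeroModeAt`, constant
`c/4`): a Feynman–Kac ground state `Ψ₀` is THE ground state of the closed form, hence the `L²`-limit of
`δ`-near-minimising trial states (`GroundStateRigidity.exists_trialState_near`), each of which occupies the
flat mode with `≥ cN` particles; `√occ` is `√N`-Lipschitz in `L²` against the continuous reference `Ψ₀`
(`sqrt_occupation_le_of_continuous`), and `occ(φ₀, Ψ₀) = N L⁻³ ∫ s_{Ψ₀}²`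
(`occupation_constMode_ofReal`). [cite: LSSY2005, §1.2 (1.19)] -/
theorem groundStateZeroModeAt_of_zeroModeAt (v : ℝ → ℝ≥0∞) (hv : Measurable v)
    (hb : ∃ C : ℝ≥0, ∀ r, v r ≤ C)
    (hZM : ∃ ρ₀ : ℝ, 0 < ρ₀ ∧ ∀ ρ : ℝ, 0 < ρ → ρ < ρ₀ → ∃ c : ℝ, 0 < c ∧ ∀ᶠ N : ℕ in atTop,
      ∃ δ : ℝ≥0∞, 0 < δ ∧ ∀ Ψ : TrialState N (sideLength ρ N),
        energy v Ψ ≤ groundStateEnergy v N (sideLength ρ N) + δ →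
        ENNReal.ofReal (c * N) ≤ occupation N ((box (sideLength ρ N)).indicator
          fun _ => ((Real.sqrt (sideLength ρ N ^ 3))⁻¹ : ℂ)) Ψ.ψ) :
    ∃ ρ₀ : ℝ, 0 < ρ₀ ∧ ∀ ρ : ℝ, 0 < ρ → ρ < ρ₀ → ∃ c : ℝ, 0 < c ∧ ∀ᶠ n : ℕ in atTop,
      ∀ Ψ₀ : Config (n + 1) → ℝ, IsGroundStateFK v (sideLength ρ (n + 1)) Ψ₀ →
        ENNReal.ofReal (c * sideLength ρ (n + 1) ^ 3) ≤
          ∫⁻ Y : Config n, (∫⁻ x, (‖Ψ₀ (Matrix.vecCons x Y)‖₊ : ℝ≥0∞)) ^ 2 := by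
  obtain ⟨C, hC⟩ := hb
  obtain ⟨ρ₁, hρ₁, H₁⟩ := hZM
  refine ⟨ρ₁, hρ₁, fun ρ hρ hρlt => ?_⟩
  obtain ⟨c, hc, hev⟩ := H₁ ρ hρ hρlt
  refine ⟨c / 4, by positivity, ?_⟩
  filter_upwards [(Filter.tendsto_add_atTop_nat 1).eventually hev] with n hn Ψ₀ hFK
  obtain ⟨δ, hδ, hocc⟩ := hn
  set L := sideLength ρ (n + 1) with hLdef
  have hLpos : 0 < L := by
    rw [hLdef]
    unfold sideLength
    exact Real.rpow_pos_of_pos (div_pos (Nat.cast_pos.mpr (Nat.succ_pos n)) hρ) _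
  have hL3 : 0 < L ^ 3 := by positivity
  have hN1 : 1 ≤ n + 1 := Nat.le_add_left 1 n
  -- `Ψ₀` is THE FK ground state: continuous, and a ground state of the closed form
  obtain ⟨hGS, hcont, -⟩ :=
    BECInsertionVariance.isGroundState_fkGroundState_of_bounded hN1 hLpos hv ⟨C, hC⟩
  rw [← hFK.eq_fkGroundState] at hGS hcont
  -- a `δ`-near-minimising trial state `(c/4)`-close to `Ψ₀`
  obtain ⟨T, hTE, hTclose⟩ := GroundStateRigidity.exists_trialState_near hGS hδ
    (ε := ENNReal.ofReal (c / 4)) (ENNReal.ofReal_pos.2 (by positivity))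
  have hoccT := hocc T hTE
  set φ₀ : Space → ℂ := (box L).indicator fun _ => ((Real.sqrt (L ^ 3))⁻¹ : ℂ) with hφ₀def
  have hφm : AEStronglyMeasurable φ₀ volume :=
    _root_.AtomisticToContinuum.BECInfraredBound.aestronglyMeasurable_constMode L
  have hφ1 : ∫⁻ x, (‖φ₀ x‖₊ : ℝ≥0∞) ^ 2 = 1 :=
    _root_.AtomisticToContinuum.BECInfraredBound.lintegral_constMode_sq hLpos
  have hoccref : occupation (n + 1) φ₀ (fun X => (Ψ₀ X : ℂ)) =
      (n + 1 : ℝ≥0∞) * ((ENNReal.ofReal (L ^ 3))⁻¹ *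
        ∫⁻ Y : Config n, (∫⁻ x, (‖Ψ₀ (Matrix.vecCons x Y)‖₊ : ℝ≥0∞)) ^ 2) :=
    occupation_constMode_ofReal hLpos hcont hFK.eq_zero hFK.nonneg
  set K : ℝ≥0∞ := ENNReal.ofReal (1 / c) with hKdef
  have hK0 : K ≠ 0 := (ENNReal.ofReal_pos.mpr (by positivity)).ne'
  have hNcast : ((n + 1 : ℕ) : ℝ≥0∞) = (n + 1 : ℝ≥0∞) := by push_cast; rfl
  -- `N ≤ occ(T) · (1/c)`
  have h1 : ((n + 1 : ℕ) : ℝ≥0∞) ≤ occupation (n + 1) φ₀ T.ψ * K := by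
    have hcK : ENNReal.ofReal c * K = 1 := by
      rw [hKdef, one_div, ENNReal.ofReal_inv_of_pos hc,
        ENNReal.mul_inv_cancel (ENNReal.ofReal_pos.2 hc).ne' ENNReal.ofReal_ne_top]
    calc ((n + 1 : ℕ) : ℝ≥0∞) = ENNReal.ofReal (c * ((n + 1 : ℕ) : ℝ)) * K := by
          rw [ENNReal.ofReal_mul hc.le, ENNReal.ofReal_natCast, mul_comm (ENNReal.ofReal c), mul_assoc,
            hcK, mul_one]
      _ ≤ occupation (n + 1) φ₀ T.ψ * K := mul_le_mul_left hoccT _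
  -- stability with unit phase `1`
  have h2 := sqrt_occupation_le_of_continuous hφm hφ1 T.contDiff.continuous
    (Φ := fun X => (Ψ₀ X : ℂ)) (Complex.continuous_ofReal.comp hcont) (c := 1) (by simp)
  simp only [one_mul] at h2
  have hE' : ∫⁻ X, (‖T.ψ X - (Ψ₀ X : ℂ)‖₊ : ℝ≥0∞) ^ 2 ≤ (4 * K)⁻¹ := by
    refine hTclose.trans (le_of_eq ?_)
    rw [hKdef, show c / 4 = (4 * (1 / c))⁻¹ by field_simp, ENNReal.ofReal_inv_of_pos (by positivity),
      ENNReal.ofReal_mul (by norm_num), ENNReal.ofReal_ofNat]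
  have key := zeroMode_sqrt_bookkeeping hK0 (ENNReal.natCast_ne_top (n + 1)) h1 h2 hE'
  -- `N · ofReal (c/4) ≤ N · (L⁻³ ∫ s²)`, cancel `N`, clear `L³`
  rw [hoccref, ← hNcast] at key
  have hkey' : ((n + 1 : ℕ) : ℝ≥0∞) * ENNReal.ofReal (c / 4) ≤
      ((n + 1 : ℕ) : ℝ≥0∞) * ((ENNReal.ofReal (L ^ 3))⁻¹ *
        ∫⁻ Y : Config n, (∫⁻ x, (‖Ψ₀ (Matrix.vecCons x Y)‖₊ : ℝ≥0∞)) ^ 2) := by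
    refine le_trans (le_of_eq ?_) key
    rw [hKdef, show c / 4 = 1 / (4 * (1 / c)) by field_simp, one_div (4 * (1 / c)),
      ENNReal.ofReal_inv_of_pos (by positivity), ENNReal.ofReal_mul (by norm_num), ENNReal.ofReal_ofNat,
      ENNReal.div_eq_inv_mul, mul_comm]
  have hN0 : ((n + 1 : ℕ) : ℝ≥0∞) ≠ 0 := Nat.cast_ne_zero.2 (Nat.succ_ne_zero n)
  have hcancel := (ENNReal.mul_le_mul_iff_right hN0 (ENNReal.natCast_ne_top (n + 1))).1 hkey'
  have hA0 : ENNReal.ofReal (L ^ 3) ≠ 0 := (ENNReal.ofReal_pos.2 hL3).ne'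
  have hmul : ENNReal.ofReal (c / 4) * ENNReal.ofReal (L ^ 3) ≤
      ∫⁻ Y : Config n, (∫⁻ x, (‖Ψ₀ (Matrix.vecCons x Y)‖₊ : ℝ≥0∞)) ^ 2 := by
    rw [mul_comm ((ENNReal.ofReal (L ^ 3))⁻¹), ← div_eq_mul_inv] at hcancel
    exact (ENNReal.le_div_iff_mul_le (Or.inl hA0) (Or.inl ENNReal.ofReal_ne_top)).1 hcancel
  rwa [← ENNReal.ofReal_mul (by positivity)] at hmul

/-- **On bounded potentials, the open stub `Z` IS item stmt-AtomisticToContinuum-0686 — by name.**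
Restricted to bounded admissible pair potentials, the late-time zero-mode bound of the heat-flow witness
(`WitnessZeroMode`, the core stub of the line `late-core-split`) is EQUIVALENT to the zero-mode thesis
`BECInfraredBound.BecZeroModeThesis` of item 0686 (macroscopic flat-mode occupation of every
near-minimiser at small density, for all large `N`): `Z|bdd ⟺` ground-state flat-mode ODLRO
(`witnessZeroModeBdd_iff_groundStateZeroMode`, p140987) `⟺` zero mode of near-minimisers
(`zeroModeAt_of_groundStateZeroModeAt` / `groundStateZeroModeAt_of_zeroModeAt`).
[cite: LSSY2005, §1.2 (1.19) and Ch. 5] -/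
theorem witnessZeroModeBdd_iff_becZeroModeBdd :
    (∀ v : ℝ → ℝ≥0∞, IsRepulsiveFiniteRange v → (∃ C : ℝ≥0, ∀ r, v r ≤ C) →
      ∃ ρ₀ : ℝ, 0 < ρ₀ ∧ ∀ ρ : ℝ, 0 < ρ → ρ < ρ₀ → ∃ c : ℝ, 0 < c ∧ ∀ᶠ n : ℕ in atTop,
        ∀ᶠ T : ℝ in atTop, ENNReal.ofReal (c * sideLength ρ (n + 1) ^ 3) ≤ sliceMassSq v ρ n T) ↔
    (∀ v : ℝ → ℝ≥0∞, IsRepulsiveFiniteRange v → (∃ C : ℝ≥0, ∀ r, v r ≤ C) →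
      ∃ ρ₀ : ℝ, 0 < ρ₀ ∧ ∀ ρ : ℝ, 0 < ρ → ρ < ρ₀ → ∃ c : ℝ, 0 < c ∧ ∀ᶠ N : ℕ in atTop,
        ∃ δ : ℝ≥0∞, 0 < δ ∧ ∀ Ψ : TrialState N (sideLength ρ N),
          energy v Ψ ≤ groundStateEnergy v N (sideLength ρ N) + δ →
          ENNReal.ofReal (c * N) ≤ occupation N ((box (sideLength ρ N)).indicator
            fun _ => ((Real.sqrt (sideLength ρ N ^ 3))⁻¹ : ℂ)) Ψ.ψ) := by
  constructor
  · intro hZ v hv hb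
    exact zeroModeAt_of_groundStateZeroModeAt v hv.1 hb (groundStateZeroMode_of_witnessZeroModeBdd hZ v hv hb)
  · intro hB
    exact stub_witnessZeroModeOfGroundState fun v hv hb =>
      groundStateZeroModeAt_of_zeroModeAt v hv.1 hb (hB v hv hb)

/-- **Item 0686 by name ⟹ the open stub `Z` on bounded potentials**: the zero-mode thesis
`BECInfraredBound.BecZeroModeThesis` (stmt-AtomisticToContinuum-0686, X_B1) gives `WitnessZeroMode`
restricted to bounded admissible potentials. [cite: LSSY2005, §1.2 (1.19)] -/
theorem witnessZeroModeBdd_of_becZeroModeThesis (hB : BECInfraredBound.BecZeroModeThesis) :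
    ∀ v : ℝ → ℝ≥0∞, IsRepulsiveFiniteRange v → (∃ C : ℝ≥0, ∀ r, v r ≤ C) →
      ∃ ρ₀ : ℝ, 0 < ρ₀ ∧ ∀ ρ : ℝ, 0 < ρ → ρ < ρ₀ → ∃ c : ℝ, 0 < c ∧ ∀ᶠ n : ℕ in atTop,
        ∀ᶠ T : ℝ in atTop, ENNReal.ofReal (c * sideLength ρ (n + 1) ^ 3) ≤ sliceMassSq v ρ n T :=
  witnessZeroModeBdd_iff_becZeroModeBdd.2 fun v hv _ => hB v hv

/-! ### The stub `Z` alone ⟹ the summit predicate on bounded potentials -/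

/-- **`Z` restricted to bounded potentials ⟹ LSSY's BEC criterion there.** If the late-time zero-mode
bound `∫ s_T² ≥ c L³` of the heat-flow witness holds eventually in `T` for all large `n` at every bounded
admissible `v` and small `ρ`, then `HasGroundStateBEC v ρ` for every bounded admissible `v` and every
`ρ < ρ₀(v)`: `Z|bdd ⟹` ground-state flat-mode ODLRO (`groundStateZeroMode_of_witnessZeroModeBdd`, p140987)
`⟹` zero mode at `v` (`zeroModeAt_of_groundStateZeroModeAt`) `⟹` `HasGroundStateBEC`
(`hasGroundStateBEC_of_zeroModeAt`, p153414). [cite: LSSY2005, §1.2 (1.19) and Ch. 5 p. 42] -/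
theorem hasGroundStateBEC_of_witnessZeroModeBdd
    (hZ : ∀ v : ℝ → ℝ≥0∞, IsRepulsiveFiniteRange v → (∃ C : ℝ≥0, ∀ r, v r ≤ C) →
      ∃ ρ₀ : ℝ, 0 < ρ₀ ∧ ∀ ρ : ℝ, 0 < ρ → ρ < ρ₀ → ∃ c : ℝ, 0 < c ∧ ∀ᶠ n : ℕ in atTop,
        ∀ᶠ T : ℝ in atTop, ENNReal.ofReal (c * sideLength ρ (n + 1) ^ 3) ≤ sliceMassSq v ρ n T) :
    ∀ v : ℝ → ℝ≥0∞, IsRepulsiveFiniteRange v → (∃ C : ℝ≥0, ∀ r, v r ≤ C) →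
      ∃ ρ₀ : ℝ, 0 < ρ₀ ∧ ∀ ρ : ℝ, 0 < ρ → ρ < ρ₀ → HasGroundStateBEC v ρ := by
  intro v hv hb
  obtain ⟨ρ₀, hρ₀, H⟩ := zeroModeAt_of_groundStateZeroModeAt v hv.1 hb
    (groundStateZeroMode_of_witnessZeroModeBdd hZ v hv hb)
  exact ⟨ρ₀, hρ₀, fun ρ hρ hρlt => hasGroundStateBEC_of_zeroModeAt hρ (H ρ hρ hρlt)⟩

/-- **The open core stub ALONE gives the zero-mode statement of item stmt-AtomisticToContinuum-0686 on
bounded potentials**: `WitnessZeroMode` ⟹ for every bounded admissible `v`, at every small density,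
macroscopic occupation of the flat mode in every near-minimiser for all large `N` (no `A`, no 9072).
[cite: LSSY2005, §1.2 (1.19)] -/
theorem becZeroModeAt_bounded_of_witnessZeroMode (hZ : WitnessZeroMode) :
    ∀ v : ℝ → ℝ≥0∞, IsRepulsiveFiniteRange v → (∃ C : ℝ≥0, ∀ r, v r ≤ C) →
      ∃ ρ₀ : ℝ, 0 < ρ₀ ∧ ∀ ρ : ℝ, 0 < ρ → ρ < ρ₀ → ∃ c : ℝ, 0 < c ∧ ∀ᶠ N : ℕ in atTop,
        ∃ δ : ℝ≥0∞, 0 < δ ∧ ∀ Ψ : TrialState N (sideLength ρ N),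
          energy v Ψ ≤ groundStateEnergy v N (sideLength ρ N) + δ →
          ENNReal.ofReal (c * N) ≤ occupation N ((box (sideLength ρ N)).indicator
            fun _ => ((Real.sqrt (sideLength ρ N ^ 3))⁻¹ : ℂ)) Ψ.ψ :=
  fun v hv hb => zeroModeAt_of_groundStateZeroModeAt v hv.1 hb
    (stub_groundStateZeroModeOfWitness hZ v hv hb)

/-- **`Z` ALONE ⟹ LSSY's BEC criterion for every soft potential.** `WitnessZeroMode` — the open core
stub `stub_witnessZeroMode` of the line `late-core-split` — implies `HasGroundStateBEC v ρ` for every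
bounded repulsive finite-range `v` and all `0 < ρ < ρ₀(v)`. [cite: LSSY2005, §1.2 (1.19) and Ch. 5 p. 42] -/
theorem hasGroundStateBEC_bounded_of_witnessZeroMode (hZ : WitnessZeroMode) :
    ∀ v : ℝ → ℝ≥0∞, IsRepulsiveFiniteRange v → (∃ C : ℝ≥0, ∀ r, v r ≤ C) →
      ∃ ρ₀ : ℝ, 0 < ρ₀ ∧ ∀ ρ : ℝ, 0 < ρ → ρ < ρ₀ → HasGroundStateBEC v ρ :=
  hasGroundStateBEC_of_witnessZeroModeBdd fun v hv _ => hZ v hv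

/-- **Registered toolbox stub `stub_zeroModeSummitNecessityBounded`** (verbatim registered signature):
the open core stub `Z = Goal.stub_witnessZeroMode` of the held skeleton ALONE implies the summit
conjunct's predicate `HasGroundStateBEC` at every bounded admissible potential and every small density —
the stub-level form of `stub_summitNecessityBounded` (p153414), with neither the no-intermittency input
`A` nor the rigidity crux 9072. [cite: LSSY2005, §1.2 (1.19) and Ch. 5 p. 42] -/
theorem stub_zeroModeSummitNecessityBounded : Summit.AtomisticToContinuum.BoseEinsteinCondensation.Cruxes.TwoReplicaTransienceBound.LateCoreSplit.Goal.stub_witnessZeroMode → ∀ v : ℝ → ENNReal, Literature.MathematicalPhysics.QuantumManyBody.BoseGas.IsRepulsiveFiniteRange v → (∃ C : NNReal, ∀ r : ℝ, v r ≤ C) → ∃ ρ₀ : ℝ, 0 < ρ₀ ∧ ∀ ρ : ℝ, 0 < ρ → ρ < ρ₀ → Literature.MathematicalPhysics.QuantumManyBody.BoseGas.HasGroundStateBEC v ρ :=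
  hasGroundStateBEC_bounded_of_witnessZeroMode

/-- **Contrapositive — the refutation test for the STUB in summit terms.** One bounded admissible `v`
for which LSSY's criterion fails at densities accumulating at `0` refutes `Z` (and with it the crux,
`witnessZeroMode_of_crux`). [cite: LSSY2005, §1.2 (1.19)] -/
theorem not_witnessZeroMode_of_not_hasGroundStateBEC {v : ℝ → ℝ≥0∞} (hv : IsRepulsiveFiniteRange v)
    (hb : ∃ C : ℝ≥0, ∀ r, v r ≤ C)
    (h : ∀ ρ₀ : ℝ, 0 < ρ₀ → ∃ ρ : ℝ, 0 < ρ ∧ ρ < ρ₀ ∧ ¬ HasGroundStateBEC v ρ) :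
    ¬ WitnessZeroMode := by
  intro hZ
  obtain ⟨ρ₀, hρ₀, H⟩ := hasGroundStateBEC_bounded_of_witnessZeroMode hZ v hv hb
  obtain ⟨ρ, hρ, hρlt, hno⟩ := h ρ₀ hρ₀
  exact hno (H ρ hρ hρlt)

/-- **Stub and sub-problem, by name.** `Z` together with dilute ground-state BEC for the admissible
potentials that are NOT bounded (hard cores, hollow shells) gives the sub-problem statement
`BoseEinsteinCondensation` by name: on soft potentials the open stub already is the conjunct.
[cite: LSSY2005, §1.2 and Ch. 5 p. 42] -/
theorem boseEinsteinCondensation_of_witnessZeroMode_of_singularBEC (hZ : WitnessZeroMode)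
    (hS : ∀ v : ℝ → ℝ≥0∞, IsRepulsiveFiniteRange v → ¬ (∃ C : ℝ≥0, ∀ r, v r ≤ C) →
      ∃ ρ₀ : ℝ, 0 < ρ₀ ∧ ∀ ρ : ℝ, 0 < ρ → ρ < ρ₀ → HasGroundStateBEC v ρ) :
    Literature.MathematicalPhysics.QuantumManyBody.BoseGas.BoseEinsteinCondensation := by
  intro v hv
  by_cases hb : ∃ C : ℝ≥0, ∀ r, v r ≤ C
  · exact hasGroundStateBEC_bounded_of_witnessZeroMode hZ v hv hb
  · exact hS v hv hb

end Summit.AtomisticToContinuum.BoseEinsteinCondensation.Cruxes.TwoReplicaTransienceBound.LateCoreSplit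

end
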